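import Mathlib
import HarnessLib
import HarnessLib.Audit
import Summits.AtomisticToContinuum.Statement
import Summits.AtomisticToContinuum.HydrodynamicLimit.Theorems.AntiMazurCoboundariesHomogeneousInvariance
import HarnessLib.Audit.Status.Attr

/-!
Route: RingDensityCertificate

DORMANT since 2026-08-23T07:33:55Z (reconciler: no traction for 6 d (last activity statement-grounded at 2026-08-17T07:29:27Z); parked, not closed — `ledger route dormant route-AtomisticToContinuum-RingDensityCertificate --off` to react) — unstaffed, not closed; items shared with open routes are served there. `ledger route dormant <id> --off` reactivates.

# Route RingDensityCertificate — ring density of the collision forest certifies contact chaos; chaos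
in the packing band closes hs-Euler

It suffices to show X = RingSparsity ∧ RingDensityLaw ∧ RingCertificate ∧ ChaosClosure, realising
card
ring-sparse-collision-forest (spine) in CERTIFICATE form; conforming re-open (D-0027 §2.1) of the
retired route
RingSparseCollisionForest, now with a deciding theorem `closes` whose conclusion is
`_root_.HydrodynamicLimit` by name.
STATEMENT RE-TYPE D-0032 (p126922, 2026-08-16): the conjunct `_root_.HydrodynamicLimit` is now the
PACKING-GUARDED hard-sphere
Euler limit (∃ η₀ > 0 outermost; solutions with ρ_t(x)σ³ < η₀ on [0,T)) — verbatim the consequent of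
ChaosClosure — so the certificate
line reaches the Statement with NO PDE-side lift: the former lift crux DiluteSelfConsistency (shared
stmt-3091, needed only to reach the OLD
unguarded abbrev) is no longer wanted by this route (dropped at rev 5; the routes that attack or
need it keep it). Along one deterministic trajectory form the time-ordered
collision multigraph; a collision (i,j) at time s is an M-RING if the backward clusters of i and j
over the preceding window of M local
kinetic time units intersect (a cycle closes), else M-FRESH. RingSparsity: in the packing band
ρ_t(x)σ³ < η(M,δ) the cell/window ring
FRACTION is ≤ δ in probability along the local-Gibbs-started flow. RingDensityLaw: the ring fraction
converges in probability to its
EQUILIBRIUM value at the local Euler state. RingCertificate (the quasi-randomness bet,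
Chung–Graham–Wilson "normal short-cycle density ⇒
uniform edge statistics" for collision forests): RingSparsity → RingDensityLaw → ContactChaos, the
typed EMPIRICAL Enskog Stosszahlansatz
(target). ChaosClosure: ContactChaos → the packing-guarded conjunct, which since the re-type IS the
Statement, so the crux-only deciding
theorem is `closes hRing hSparse hCert hClose := have hTarget : ContactChaos := hCert hSparse hRing;
hClose hTarget`.
Lean: `RingSparsity ∧ RingDensityLaw ∧ RingCertificate ∧ ChaosClosure`

## Assembly
The deciding theorem (glue.lean, sorry-free, axioms propext/Classical.choice/Quot.sound; certified
by the gate, 2026-08-16): CRUX-ONLY —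
`theorem closes (hRing : RingDensityLaw) (hSparse : RingSparsity) (hCert : RingCertificate) (hClose
: ChaosClosure) :
_root_.HydrodynamicLimit := have hTarget : ContactChaos := hCert hSparse hRing; hClose hTarget`: the
certificate cruxes produce the
target ContactChaos and ChaosClosure maps it to the packing-guarded conjunct, i.e. the re-typed
Statement (D-0032, p126922) verbatim;
no support item, no σ₀-bookkeeping and no packing-band lift is consumed (before the re-type the
unguarded abbrev needed
DiluteSelfConsistency at the η₀ of ChaosClosure and σ₀ = min(σ₀', σ₀'')). The Assembly ITEM
(restated at rev 5, stmt-17871) is the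
frame "inputs ⇒ Statement": `RingSparsity → RingDensityLaw → ChaosClosure →
_root_.HydrodynamicLimit`, a WEAKENING of the certificate
crux RingCertificate (it closes by `fun hS hR hCl => hCl (ringCertificate hS hR)` the moment
RingCertificate closes; not
battery-provable, Sketch.lean). The rev-0 assembly stmt-12133 (`… → ChaosClosure →
DiluteSelfConsistency → HydrodynamicLimit`) was
proved against the old abbrev (`Theorems/RingDensityCertificateAssembly.lean`, broken by the re-type
at its `intro a₀ …`) and became
tauto-trivial against the re-typed Statement; it is retired, and with it the idle antecedent
DiluteSelfConsistency left the route.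

Rationale: WHY THIS LINE. The mechanism is combinatorial: make the COLLISION FOREST of a single trajectory the
object and use the density of its short cycles (rings)
as a certificate for molecular chaos, as the C₄ count certifies uniform edge distribution in
quasi-random graphs (ChungGrahamWilson1989;
sparse version ChungGraham2002; oriented graphs doi:10.1002/jgt.21701) — paid for in equilibrium
currency: the ring count is an extensive
observable whose Gibbs large deviations (dependency-graph concentration, Janson2004) transfer to the
non-equilibrium flow by ONE Cauchy–Schwarz
against the invariant law (KipnisLandim1999 Ch. 10 form), globally in time, no mixing input.
Backward clusters are the object of
AokiEtAl2015 (Thm 1, Boltzmann–Grad) and PulvirentiSimonella2021; recollision bookkeeping is the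
core of Lanford-type proofs (Lanford1975,
GST2013, PulvirentiSimonella2016, BGSSAnnals2023) and of DengHaniMa2024's cutting algorithm — all at
Boltzmann–Grad, where rings VANISH; at
fixed σ they are a positive minority, so every statement here is RELATIVE TO LOCAL EQUILIBRIUM and
exact as N → ∞ at fixed σ (defects
O(Kn), Lutsko1996), never an iterated σ → 0 limit. Imported areas: extremal/quasi-random graph
theory (certificate by cycle density), large
deviations for Gibbs fields, kinetic theory of dense gases (Enskog contact factor from the virial
theorem, VanbeijerenErnst1973,
Resibois1978). What it does that the 23 open routes do not: no entropy/ergodicity classification, no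
hierarchy or cumulant expansion
summed over Euler times, no PDE-side selection alone; it files the typed empirical-Stosszahlansatz
waypoint ContactChaos with a
certificate for it, and — heeding the negatives index (stmt 9168 was refuted precisely for
quantifying over untied, unguarded Euler
solutions) — every Euler-facing item is tied to the local-Gibbs data AND packing-guarded, — and
since the Statement re-type D-0032 (p126922, 2026-08-16) the conjunct itself carries the same
packing guard, so no PDE-side lift is needed (the former lift crux DiluteSelfConsistency, shared
stmt-3091, left this route at rev 5).

RANKED CRUXES. #0 ContactChaos (target) — EMPIRICAL ENSKOG CHAOS ALONG THE FLOW (typed waypoint): ∃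
η₀ > 0 such that for all continuous positive profiles ∃ σ₀, for σ < σ₀, every window multiplier M >
0, every classical hs-Euler solution on [0,T) in the packing band ρ_t(x)σ³ < η₀, every flow family
with the LLN at t = 0, every t < T and δ > 0 there is h₀ with: for cells B(x₀,h), h < h₀, and the
window [t, t + w_N], w_N = M/(σ²ρ_t(x₀)√θ_t(x₀)(N+1)^(1/3)) (M local kinetic time units), (SEL+ANG)
for every continuous |F| ≤ 1 the collision-sampled average of F(v_i⁻, v_j⁻, ω_ij) (incoming
velocities = left limits, ω = ε⁻¹·sepVec) over ordered collisions with x_i in the cell differs from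
the flux-biased all-pairs average Σ_(i≠j in cell) ∫ F(v_i,v_j,ŷ)((v_i−v_j)·y)₋e^(−|y|²)dy
(normalised) by more than δ with probability → 0 as N → ∞; (RATE) the ordered collision count
differs from the Enskog prediction Σ_(i≠j in cell) πε_N²|v_i−v_j| w_N g_E(n_cell σ³)/|cell|, g_E(η)
= (Z(η)−1)/((2π/3)η), Z = hsCompressibility, n_cell the empirical normalised density, by more than a
factor δ with probability → 0 (card items B2/B3's common target). (why it might fail: A persistent
O(1) velocity–position pattern at the free-path scale not of ring origin (streaming lanes under
strong shear), or a contact pair density ≠ g_E(local η) out of equilibrium, breaks SEL or RATE at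
fixed σ; at finite N both defects are O(Kn) (Lutsko1996).) [Lutsko1996, Bogolyubov1975,
VanbeijerenErnst1973, Resibois1978, Spohn1991]
#2 RingDensityLaw (crux) — RING FRACTION TAKES ITS EQUILIBRIUM VALUE ALONG THE FLOW (card B1/B3
quantitative half): ∃ η₀ > 0, for all profiles ∃ σ₀, for σ < σ₀, M > 0, band-respecting classical
solutions, flows with LLN at 0, t ∈ (0,T), δ > 0 ∃ h₀: for h < h₀, x₀ and every comparison flow
family Ψ of N+1 spheres with diameter parameter σ' = σρ_t(x₀)^(1/3) (same reduced density as the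
cell), P(|Z_ring − r_E(N)·Z_coll| > δ Z_coll) → 0, where Z_coll/Z_ring count ordered (ring)
collisions in cell × window (M-rings: backward clusters over (s − w_N, s) intersect; clusters =
time-respecting collision chains, AokiEtAl2015 §1) and r_E(N) = E_Q[Z'_ring]/E_Q[Z'_coll] is the
ring fraction of the HOMOGENEOUS equilibrium system (canonical law, density 1, temperature θ_t(x₀),
diameter σ', window of the same M kinetic units). MD-measurable. [difficulty: XL] (why it might
fail: A non-equilibrium bias in WHO recollides (compression/shear changing the re-aiming geometry at
the free-path scale) would shift the ring fraction by O(1) if local equilibrium fails at scale ℓ; it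
also needs h → 0 after N → ∞ and N-stable equilibrium expectations r_E(N).) [AokiEtAl2015,
PulvirentiSimonella2021, Dorfman1999, Cohen1967, BGSSCPAM2023]
#3 RingSparsity (crux) — TREE-LIKENESS OF NON-EQUILIBRIUM COLLISION HISTORIES (card B1, all
amplitudes): for every window multiplier M > 0 and δ > 0 there is a packing threshold η(M,δ) > 0
such that for all profiles ∃ σ₀, for σ < σ₀, every classical solution with ρ_t(x)σ³ < η on [0,T),
flows with LLN at 0, t ∈ (0,T), h > 0, x₀: P(Z_ring > δ·Z_coll in B(x₀,h) × [t, t+w_N]) → 0 as N →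
∞. Small data: EquilibriumRingLD + TiltTransfer + HomogeneousInvariance give it for ALL times
(support SmallDataRingSparsity); large data: zoom (card first-failure-blowup) or a super-extensive
LD for the time-integrated ring count (card spacetime-superextensive-ld). [difficulty: L] (why it
might fail: Large data: the tilt factor e^(ΛN) beats the extensive equilibrium rate e^(−c(δ,M)N)
only for small amplitude; clusters grow like e^(CM) (AokiEtAl2015 Thm 1) so η(M,δ) ~ δe^(−2CM); a
flow-generated excess of recollisions at fixed packing would refute it.) [AokiEtAl2015,
PulvirentiSimonella2021, Janson2004, KipnisLandim1999, BGSSAnnals2023]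
#4 RingCertificate (crux) — RING DENSITY CERTIFIES CHAOS (card's programme form, CGW-type rigidity
for time-ordered collision forests): in the sparse regime (RingSparsity), equality of the window
ring fraction with its equilibrium value at the local state (RingDensityLaw) forces the empirical
Stosszahlansatz (ContactChaos). Intended mechanism: ancestry lemma (at fresh collisions incoming
data come from disjoint backward clusters, so correlation is only inherited from the mesoscopic far
field at the window start) + "excess correlation forces excess/deficient short cycles" (codegree ⇒
edge uniformity, ChungGrahamWilson1989 Thm 1 analogue; sparse ChungGraham2002; oriented
doi:10.1002/jgt.21701) + rings-in-a-local-equilibrium-medium for the ring minority; flag-algebra/SDP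
certificates over ≤ 4-collision motifs as the search tool. [deps: RingSparsity, RingDensityLaw,
ContactChaos] [difficulty: open-problem] (why it might fail: No Cauchy–Schwarz/Gram identity is
known for time-ordered collision motifs: a velocity-correlated state with EQUILIBRIUM ring density
(e.g. shear-aligned pairs) would make the certificate blind; the far-field input (off-contact k-body
LE) is itself open at fixed σ.) [ChungGrahamWilson1989, ChungGraham2002, doi:10.1002/jgt.21701,
AokiEtAl2015, PulvirentiSimonella2016, Lutsko1996]
#5 ChaosClosure (crux) — EMPIRICAL ENSKOG CHAOS CLOSES hs-EULER IN THE PACKING BAND: ContactChaos →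
HydroLimitInBand, the packing-guarded conjunct (ex stmt-AtomisticToContinuum-3093, inlined verbatim
as the consequent: ∃ η₀ > 0 ∀ profiles ∃ σ₀ ∀ σ < σ₀ ∀ classical solutions with ρ_t(x)σ³ < η₀ on
[0,T) ∀ flows, LLN at 0 ⇒ LLN at every t < T). Intended proof: Bogolyubov's exact empirical identity
for (μ^N, collision measure) (Bogolyubov1975) + SEL/ANG/RATE ⇒ empirical revised-Enskog structure in
every cell/window ⇒ H-theorem (Resibois1978) ⇒ cell velocity laws relax to local Maxwellians within
O(1) kinetic times, entropy production ≥ 0 ⇒ kinetic + collisional fluxes = (ρu⊗u + ρθZ(ρσ³)𝟙,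
(E+p)u) and the hs entropy inequality for limit points ⇒ dissipative measure-valued solution ⇒
relative-entropy weak–strong uniqueness (Dafermos1979, BrezinaFeireisl2018) ⇒ fields converge for t
< T; velocity tails by transfer of Gaussian moments against the invariant law. [deps: ContactChaos]
[difficulty: XL] (why it might fail: Chaos tested by bounded F in shrinking cells may be too weak
for a quantitative H-theorem on EMPIRICAL measures (atomic measures have no entropy: smoothing +
Cercignani-type production bounds, DesvillettesVillani2005); mv limits need the exact hs entropy
inequality.) [Resibois1978, BrezinaFeireisl2018, Dafermos1979, DesvillettesVillani2005,
Bogolyubov1975, Lachowicz1998]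
#9 EquilibriumRingLD (support) — EXTENSIVE EQUILIBRIUM LARGE DEVIATIONS FOR THE RING FRACTION (card
B1(a)): for θc > 0, M > 0, δ > 0 ∃ σ₀, for σ < σ₀ and h > 0 ∃ C > 0 such that under the homogeneous
canonical law Q_N (activity 1, velocity 0, temperature θc) of N+1 spheres, for every t, x₀, flow
family and N: Q_N(|Z_ring − r_E(N) Z_coll| > δ Z_coll in B(x₀,h) × [t, t+w_N]) ≤ C e^(−(N+1)/C),
r_E(N) = E_Q[Z_ring]/E_Q[Z_coll], w_N = M/(σ²√θc (N+1)^(1/3)). Proof sketch: velocity truncation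
(Gaussian tails), spatial near-independence of mesoscopic sub-cells over a microscopic window +
dependency-graph Bernstein/Janson bound inside, canonical-constraint decoupling; stationarity makes
C independent of t. [difficulty: M] [Janson2004, KipnisLandim1999, Ruelle1969, AokiEtAl2015]
#9 TiltTransfer (support) — CAUCHY–SCHWARZ TRANSFER AGAINST THE INVARIANT LAW (card B4), dilute
form: for 0 < σ < 1/4, continuous positive profiles (a₀,u₀,θ₀) and θc with θ₀ < 2θc pointwise there
is Λ such that for all N, flows Φ, times t and measurable B: (lawAt Φ P_N t)(B) ≤ e^(Λ(N+1)) ·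
Q_N(B)^(1/2), P_N = localGibbsLaw σ a₀ u₀ θ₀ N Φ, Q_N = homogeneous law (1, 0, θc). Proof: P_t(B) =
∫ 1_B∘Φ_t · (dP/dQ) dQ ≤ Q(Φ_t⁻¹B)^(1/2) ‖dP/dQ‖_(L²(Q)), invariance of Q (HomogeneousInvariance),
‖dP/dQ‖² ≤ (Z_Q/Z_P²)·K^(N+1) with K = sup_x ∫ (a₀M_(u₀,θ₀))²/M_(0,θc) dv < ∞ iff θ₀ < 2θc, Z_P ≥
(inf a₀)^(N+1) Z_Q and Z_Q ≥ (1 − (32π/3)σ³)^(N+1) by sequential insertion (σ < 1/4); both sides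
vanish when the partition function does. [difficulty: provable-now] [KipnisLandim1999, Spohn1991,
GST2013]
#9 HomogeneousInvariance (support) — (shared verbatim with stmt-AtomisticToContinuum-3073) the
canonical law with constant profiles is invariant under every hard-sphere flow: lawAt Φ p t = p
(Liouville preservation HardSphereFlow.measurePreserving, energy and momentum conservation along
IsHardSphereTrajectory, invariance of the good set; both sides are the zero measure when the
partition function vanishes). [difficulty: provable-now] [GST2013, CIP1994, Alexander1975]
#9 SmallDataRingSparsity (support) — SMALL-DATA TREE-LIKENESS FOR ALL TIMES (card B1(a)+(b), the
concrete deliverable): for c, θc > 0, M > 0, δ > 0 ∃ σ₀, for σ < σ₀ ∃ η₀ > 0 such that for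
continuous positive profiles within η₀ of the constants (|a₀−c|, ‖u₀‖, |θ₀−θc| ≤ η₀), every flow
family, EVERY time t ∈ ℝ, h > 0, x₀: P_N(Z_ring > δ Z_coll in B(x₀,h) × [t, t+w_N]) → 0, w_N =
M/(σ²√θc(N+1)^(1/3)). From EquilibriumRingLD (+ smallness of r_E: r_E(N) ≤ δ/2 for σ < σ₀(M,δ,c), an
Enskog-level three-body re-aiming computation, Dorfman1999 §16) and TiltTransfer with Λ(η₀) <
1/(2C): a rigorous dynamical statement at fixed density valid for all macroscopic times with no
mixing input. [difficulty: M] [Janson2004, KipnisLandim1999, AokiEtAl2015, Dorfman1999]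
#1 Assembly (assembly, restated rev 5, stmt-17871) — RingSparsity → RingDensityLaw → ChaosClosure →
HydrodynamicLimit, the frame "inputs ⇒ Statement", a weakening of RingCertificate (closes from it in
one line); replaces the rev-0 frame stmt-12133 (proved against the old abbrev, tauto-trivial after
the re-type). DROPPED at rev 5: DiluteSelfConsistency (shared stmt-3091) — the packing-band lift was
needed only for the OLD unguarded abbrev; since D-0032 the Statement carries the guard, `closes`
never consumes it, and this route should not go BROKEN if DenseExcursion refutes it. [Spohn1991,
OllaVaradhanYau1993]

TWO-LAYER PLAN. Foreseen glued splits (k ≤ 3, depth 1; nothing filed now): RingCertificate ⇐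
FarFieldToFresh (ancestry lemma: off-contact k-body local
equilibrium at the window start ⇒ fresh-collision statistics equal their equilibrium counterparts) →
RingsInLEMedium (3–4-body
recollision events completed within M kinetic units in a medium whose fields vary by O(Kn) have
equilibrium statistics) →
RingCertificate. ChaosClosure ⇐ EmpiricalHTheorem (cell Maxwellianisation + entropy production from
SEL/ANG/RATE) →
FluxAndEntropyClosure (dissipative mv solution with the hs EOS and entropy) → weak–strong uniqueness
→ ChaosClosure. RingSparsity ⇐
SmallDataRingSparsity (support, all times) → LargeDataLift (zoom, or time-integrated super-extensive
LD) → RingSparsity.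
(DiluteSelfConsistency left the route at rev 5; its PDE programme GenericShockStability →
ImplosionEjection belongs to the routes that
still consume it or attack its negation, e.g. ImplosionDichotomy.)

KILL CRITERIA. ¬RingCertificate by an explicit balanced, ring-normal but non-chaotic family (MD:
equilibrium ring density with an O(1) SEL defect)
closes the route `refuted:RingCertificate` — the certificate idea is dead;
RingSparsity/SmallDataRingSparsity survive as stand-alone
tree-likeness theorems. ¬RingDensityLaw (ring fraction along sheared/compressed local-Gibbs runs ≠
equilibrium value at equal local state,
persisting in N) forces a pivot to the one-sided certificate (ring EXCESS only) or closes the route.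
¬RingSparsity at small amplitude
contradicts EquilibriumRingLD + TiltTransfer — would be major news (check the LD first).
¬DiluteSelfConsistency (a DenseExcursion-type
theorem) no longer touches this route: the operator re-ruled the Statement to the guarded conjunct
(D-0032, p126922), the crux-only
`closes` never consumed the lift afterwards, and the item was dropped from this route (rev 5).
¬ContactChaos kills every kinetic-flavoured line on the board; record as a summit-level negative.
The Statement (= HydroLimitInBandDim 3,
`hydroLimitInBandDim_three_iff_root`) proved elsewhere moots ChaosClosure but not the certificate
cruxes.

NOT DECOMPOSED YET. The ancestry lemma and the far-field (off-contact k-body) local-equilibrium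
statement it consumes; the equilibrium three-body
computation of r_E (Enskog-level re-aiming integral) and its N-stability; the flag-algebra/SDP
certificate search over ≤ 4-collision
motifs (kit job, card B5); the large-data lift of RingSparsity; every constant (η(M,δ) ~ δe^(−2CM),
C of the LD, Λ of the tilt);
velocity-tail control inside ChaosClosure; d = 3 only; the time-symmetric variant of "ring"
(backward ∪ forward clusters). All are layer-2 children or prover-side lemmas (--supports).

CHEAPEST FALSIFIER. Event-driven MD at packing 0.02–0.1, N = 10⁵–10⁶, Kolmogorov shear and a
pre-shock compression wave from local-Gibbs data: per
cell/window measure (i) the M-ring fraction vs the equilibrium run at equal (η, θ) — RingDensityLaw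
predicts agreement to o(1),
RingSparsity predicts ≤ C_M η; (ii) the SEL/ANG two-sample distance between collision-sampled (v⁻,
v*⁻, ω) and the flux-biased all-pairs
law, and the collision count vs the Enskog prediction — ContactChaos predicts defects ∝ Kn =
N^(-1/3); (iii) decisive for THIS route: bin
cells by ring-fraction deviation and by SEL defect — RingCertificate predicts no cell population
with normal ring density but O(1) SEL
defect. Analytic cheapest check: the velocity bias of the 3-body single-recollision sub-population
at equilibrium is O(1), confirming
that only relative-to-equilibrium statements can be true (already built in). Formal cheapest check
run by the planner: the whole route
file + `closes` elaborates (lean check rc 0, axioms propext/Classical.choice/Quot.sound).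

NUMBERS. Fixed reduced density (N+1)ε³ = σ³; Kn ≍ (N+1)^(-1/3); window w_N = M/(σ²ρ√θ(N+1)^(1/3)) =
M local kinetic units, M = 1 ≈ 4.4ρ√θ mean
free times at unit normalised density; collisions in a cell of radius h per window ≍ N h³ M → ∞.
Backward-cluster size over M kinetic
units: e^(C̃M) − 1 ≤ ⟨K⟩ ≤ C₂(e^(C₁M) − 1) at Boltzmann–Grad (AokiEtAl2015 Thm 1, MD-confirmed §5),
so the equilibrium ring fraction is
r_E ≈ C e^(2CM)·η at packing-type parameter η = ρσ³ (leading events: 3-body single recollision,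
Cohen1967 §2 (11a)–(14)); Enskog
contact factor g_E(η) = (Z(η) − 1)/((2π/3)η) = 1 + O(η). Transfer: P_t(B) ≤ e^(Λ(N+1)) Q(B)^(1/2) is
useful iff the equilibrium cost
c(δ,M) > 2Λ; Λ = O(amplitude); free volume ≥ (1 − (32π/3)σ³)^(N+1) ≥ 0.47^(N+1) for σ < 1/4.
SEL/ANG/LE defects at finite N: O(φ·Kn),
O(φ·Kn), O(Kn) (Lutsko1996). Items at open: 11 (1 target, 5 cruxes of which 1 shared (3091), 4
supports of which 1 shared (3073), 1
assembly); after the re-type repair 2026-08-16 (rev 5): 10 items — 1 target (ContactChaos, crux-kind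
r0), 4 cruxes, 4 supports (12131, 9621
proved), 1 assembly (restated stmt-17871; the rev-0 assembly 12133, proved against the old abbrev,
retired); shared 3091 dropped; all typed; Sketch.lean rc 0; negatives index read (6 refuted
statements, none restated; 9168's lesson applied).

DEFINITION REQUESTS. None filed now: backward clusters, M-ring collisions, cell/window collision
counts and the flux-biased reference functional are
INLINED as `let`s in each item (self-contained Props over
Literature.Analysis.FluidPDE.HardSphereFlow, contactSet, Torus.geometry,
Torus.euclidDist, Function.leftLim, finsum). If a grounder prefers named notions, the natural
requests are `collisionForest` /
`backwardCluster` / `IsRingCollision` under topic Literature/MathematicalPhysics/KineticTheory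
(AokiEtAl2015 §1 definition). No cite
facts requested (AokiEtAl2015 Thm 1 is Boltzmann–Grad and would not discharge anything here).
Precomputed payload views
(cone_inventory, ideas_index, existing_cards) were absent on this hub at planning time; the card
file, the 100 route files of the
sub-problem and the negatives index were read directly instead.

Novelty: Searches (2026-08-15): card + gen-1 route + refuter novelty audit searches of this morning (zbMATH
"backward clusters hard sphere",
"recollisions hard spheres"; crossref "fraction of recollisions ring collisions hard sphere MD",
"molecular chaos pre-collisional velocity
correlations hard sphere fluid shear"; `lit frontier AtomisticToContinuum --since 2020`; `lit
bridges AtomisticToContinuum --cross any`)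
re-used; re-run now: `lit search --source crossref "backward clusters hard sphere collision graph
quasi-random"` (8: doi:10.1002/jgt.21701
quasi-random ORIENTED graphs, doi:10.1142/s0218202515500256 = AokiEtAl2015,
doi:10.20944/preprints202606.2218.v1 Hawkes-process model of
hard-sphere collision statistics 2026 — a self-exciting fit, no certificate/LD role); `lit frontier
AtomisticToContinuum --since 2024` (30
rows: DHM expositions arXiv:2602.04407, binary-collision moderate deviations
doi:10.1007/s10955-026-03570-w, heat equation from
deterministic dynamics doi:10.1007/s00222-026-01429-1 — nothing on cycle statistics of collision
graphs at fixed density); `lit galaxy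
search "ring collisions" --star all` (45 rows, all noise) and `--star panama --title-contains
"kinetic theory" "ring events"` (5 textbooks:
Liboff, Soto, Cercignani ed. — ring events as the classical Dorfman–Cohen correction, estimated
never certified); `lit search` hybrid
index unavailable (searchd rc 75) at planning time. The 100 route files of the sub-problem were
grepped: only AlphaScalingLadder uses
backwa  [refs: 10.1002/jgt.21701, 10.1142/s0218202515500256, 10.20944/preprints202606.2218.v1, 10.1007/s10955-026-03570-w, 10.1007/s00222-026-01429-1, 2602.04407, doi:10.1002/jgt.21701, doi:10.1142/s0218202515500256, doi:10.20944/preprints202606.2218.v1, doi:10.1007/s10955-026-03570-w, doi:10.1007/s00222-026-01429-1, AokiEtAl2015, PulvirentiSimonella2021, PulvirentiSimonella2016, DengHaniMa2024, ChungGrahamWilso]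

Barriers (technique_class: quasi-randomness, collision-graph, ld-transfer): - technique_class: quasi-randomness, collision-graph, ld-transfer
- Literature.Barriers.AtomisticToContinuum.NoDensityExpansionBarrier: engaged in spirit (rings are
its leading events) but not in its technique class: nothing is expanded in density or time and no
transport coefficient appears (Euler order); rings are COUNTED over windows of M = O(1) kinetic
units (the convergent few-mean-free-time part of Cohen's expansion) and their contribution is only
required to match local equilibrium (RingDensityLaw / ContactChaos), never resummed; the bet is that
the certificate step needs no term-by-term control of histories longer than M.
- Literature.Barriers.AtomisticToContinuum.DiluteRegimeBarrier: evaded in form and substance — σ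
fixed, no Boltzmann–Grad or iterated σ → 0 limit inside any item (the "∀δ ∃σ₀" forms that would
smuggle one were rejected; η(M,δ) is a packing threshold at fixed σ); Boltzmann–Grad cluster results
(AokiEtAl2015) enter only as calibration of r_E and η(M,δ); the EOS is the full Z(ρσ³).
- Literature.Barriers.AtomisticToContinuum.BoltzmannHypothesisBarrier: no entropy method and no
classification of stationary states of the infinite system; the closure input is the typed empirical
Stosszahlansatz ContactChaos, which visibly FAILS for the barrier's ideal-gas witness (no collisions
⇒ RATE clause false, ballistic memory) — consistent; BoltzmannHypothesisBarrierNarrow likewise not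
engaged.
- Literature.Barriers.AtomisticToContinuum.HighMomentumCutoffBarrier: not

Novelty grade: new-combination — ROUTE REVIEW (refuter rreview-0815T18-20): SURVIVES. Conforming re-open of retired RingSparseCollisionForest (Literature-name assembly; items moot, none refuted) — not a recombination of refuted content; 6 negatives not restated. Probe W1.lean rc0 for all 11 decls; Assembly PROVED (candidate on stmt (refuter refuter-rreview-0815T18-20-0, 2026-08-15T19:31:12Z; prior: doi:10.1142/s0218202515500256, doi:10.3934/dcds.2021021, PulvirentiSimonella2016, doi:10.1007/bf02125347, DengHaniMa2024, Dorfman1999 §16)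

History (route lifecycle, newest last):
- 2026-08-16T03:49:07Z · AUTO-CRUX (backfill): ContactChaos — hypotheses of the deciding theorem that nothing in the route derives are cruxes (operator:999:586464)
- 2026-08-16T23:42:24Z · rev 5: restated Assembly (stmt-AtomisticToContinuum-12133 proved) — route-repair step 5 (re-type D-0032): Assembly 12133 restated — its rev-0 text became tauto-trivial against the re-typed Statement (ground.trivial BLOCKING, REA (planner-rrepair-AtomisticToContinuum-RingDensi-4838805e-0)
- 2026-08-16T23:42:24Z · rev 5: dropped DiluteSelfConsistency — route-repair step 5 (re-type D-0032): Assembly 12133 restated — its rev-0 text became tauto-trivial against the re-typed Statement (ground.trivial BLOCKING, REA (planner-rrepair-AtomisticToContinuum-RingDensi-4838805e-0)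
- 2026-08-16T23:52:00Z · rev 7: dropped DiluteSelfConsistency — route-repair step 7: drop DiluteSelfConsistency (shared 3091) from THIS route — idle since the re-type D-0032 (the Statement carries the packing guard; the crux (planner-rrepair-AtomisticToContinuum-RingDensi-4838805e-0)
- 2026-08-23T07:33:55Z · DORMANT — reconciler: no traction for 6 d (last activity statement-grounded at 2026-08-17T07:29:27Z); parked, not closed — `ledger route dormant route-AtomisticToContinuu (operator:999:3546461)

sub-problem: HydrodynamicLimit · status: dormant · opened planner-plancard-AtomisticToContinuum-Hydrody-a230b4b5-g2-0 2026-08-15T18:50:05Z · rev 7 · ledger route-AtomisticToContinuum-RingDensityCertificate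
GENERATED by the gate from the ledger (D-0016/17). Provers cite these decls: `theorem foo : Summit.AtomisticToContinuum.HydrodynamicLimit.Theses.RingDensityCertificate.<Decl> := …` in Summits/AtomisticToContinuum/HydrodynamicLimit/Theorems/<Name>.lean.
-/

namespace Summit.AtomisticToContinuum.HydrodynamicLimit.Theses.RingDensityCertificate

open scoped BigOperators Topology Manifold Classical MeasureTheory ProbabilityTheory Matrix InnerProductSpace ComplexConjugate ContinuousMap
open Filter Set Function TopologicalSpace MeasureTheory

attribute [summit_statement] _root_.HydrodynamicLimit

/-- item stmt-AtomisticToContinuum-12125 · crux (kind.auto-crux: conjecture-grade) · rank 0 · open · by planner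
why it might fail: A persistent O(1) velocity–position pattern at the free-path scale not of ring origin (streaming lanes under strong shear), or a contact pair density ≠ g_E(local η) out of equilibrium, breaks SEL or RATE at fixed σ; at finite N both defects are O(Kn) (Lutsko1996).
sources: Lutsko1996, Bogolyubov1975, VanbeijerenErnst1973, Resibois1978, Spohn1991
[target] EMPIRICAL ENSKOG CHAOS ALONG THE FLOW (typed waypoint): ∃ η₀ > 0 such that for all
continuous positive profiles ∃ σ₀, for σ < σ₀, every window multiplier M > 0, every classical
hs-Euler solution on [0,T) in the packing band ρ_t(x)σ³ < η₀, every flow family with the LLN at t =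
0, every t < T and δ > 0 there is h₀ with: for cells B(x₀,h), h < h₀, and the window [t, t + w_N],
w_N = M/(σ²ρ_t(x₀)√θ_t(x₀)(N+1)^(1/3)) (M local kinetic time units), (SEL+ANG) for every continuous
|F| ≤ 1 the collision-sampled average of F(v_i⁻, v_j⁻, ω_ij) (incoming velocities = left limits, ω =
ε⁻¹·sepVec) over ordered collisions with x_i in the cell differs from the flux-biased all-pairs
average Σ_(i≠j in cell) ∫ F(v_i,v_j,ŷ)((v_i−v_j)·y)₋e^(−|y|²)dy (normalised) by more than δ with
probability → 0 as N → ∞; (RATE) the ordered collision count differs from the Enskog prediction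
Σ_(i≠j in cell) πε_N²|v_i−v_j| w_N g_E(n_cell σ³)/|cell|, g_E(η) = (Z(η)−1)/((2π/3)η), Z =
hsCompressibility, n_cell the empirical normalised density, by more than a factor δ with probability
→ 0 (card items B2/B3's common target). -/
@[route_item "route-AtomisticToContinuum-RingDensityCertificate"]
def ContactChaos : Prop :=
  ∃ η₀ : ℝ, 0 < η₀ ∧ ∀ (a₀ θ₀ : UnitAddTorus (Fin 3) → ℝ) (u₀ : UnitAddTorus (Fin 3) → EuclideanSpace ℝ (Fin 3)), Continuous a₀ → Continuous θ₀ → Continuous u₀ → (∀ x, 0 < a₀ x) → (∀ x, 0 < θ₀ x) → ∃ σ₀ : ℝ, 0 < σ₀ ∧ ∀ σ : ℝ, 0 < σ → σ < σ₀ → ∀ M : ℝ, 0 < M → ∀ (T : ℝ) (ρ θ : ℝ → UnitAddTorus (Fin 3) → ℝ) (u : ℝ → UnitAddTorus (Fin 3) → EuclideanSpace ℝ (Fin 3)), Literature.MathematicalPhysics.KineticTheory.IsHardSphereEulerSolution σ T ρ u θ → (∀ t ∈ Set.Ico 0 T, ∀ x, ρ t x * σ ^ 3 < η₀) → ∀ Φ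 : (N : ℕ) → Literature.Analysis.FluidPDE.HardSphereFlow (Literature.Analysis.FluidPDE.Torus.geometry (Fin 3)) (Literature.MathematicalPhysics.KineticTheory.hsDiameter σ N) (N + 1), Literature.MathematicalPhysics.KineticTheory.TendstoHydroFieldsAt (fun N => Literature.MathematicalPhysics.KineticTheory.localGibbsLaw σ a₀ u₀ θ₀ N (Φ N)) Φ ρ u θ 0 → ∀ t ∈ Set.Ico 0 T, ∀ δ : ℝ, 0 < δ → ∃ h₀ : ℝ, 0 < h₀ ∧ ∀ h : ℝ, 0 < h → h < h₀ → ∀ x₀ : UnitAddTorus (Fin 3), ∀ F : EuclideanSpace ℝ (Fin 3) → EuclideanSpace ℝ (Fin 3) → EuclideanSpace ℝ (Fin 3) → ℝ, Continuous (fun p : EuclideanSpace ℝ (Fin 3) × EuclideanSpace ℝ (Fin 3) × EuclideanSpace ℝ (Fin 3) => F p.1 p.2.1 p.2.2) → (∀ v v' ω, |F v v' ω| ≤ 1) → let w : ℕ → ℝ := fun N => M / (σ ^ 2 * (ρ t x₀ * Real.sqrt (θ t x₀) * ((N + 1 : ℕ) : ℝ) ^ (1 / 3 : ℝ))); let Sc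 := fun (N : ℕ) (z : Literature.Analysis.FluidPDE.Config (N + 1) (Fin 3) (UnitAddTorus (Fin 3))) (E : EuclideanSpace ℝ (Fin 3) → EuclideanSpace ℝ (Fin 3) → EuclideanSpace ℝ (Fin 3) → ℝ) => ∑ i : Fin (N + 1), ∑ j : Fin (N + 1), if i ≠ j then ∑ᶠ s ∈ {s : ℝ | s ∈ Set.Icc t (t + w N) ∧ (Φ N).flow s z ∈ Literature.Analysis.FluidPDE.contactSet (Literature.Analysis.FluidPDE.Torus.geometry (Fin 3)) (N + 1) (Literature.MathematicalPhysics.KineticTheory.hsDiameter σ N) i j ∧ Literature.Analysis.FluidPDE.Torus.euclidDist ((Φ N).flow s z i).1 x₀ < h}, E (Function.leftLim (fun s => (Φ N).flow s z) s i).2 (Function.leftLim (fun s => (Φ N).flow s z) s j).2 ((Literature.MathematicalPhysics.KineticTheory.hsDiameter σ N)⁻¹ • (Literature.Analysis.FluidPDE.Torus.geometry (Fin 3)).sepVec ((Φ N).flow s z i).1 ((Φ N).flow s z j).1) else 0; let Sr := fun (N : ℕ) (z : Literature.Analysis.FluidPDE.Config (N + 1) (Fin 3) (UnitAddTorus (Fin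 3))) (E : EuclideanSpace ℝ (Fin 3) → EuclideanSpace ℝ (Fin 3) → EuclideanSpace ℝ (Fin 3) → ℝ) => ∑ i : Fin (N + 1), ∑ j : Fin (N + 1), if i ≠ j ∧ Literature.Analysis.FluidPDE.Torus.euclidDist ((Φ N).flow t z i).1 x₀ < h ∧ Literature.Analysis.FluidPDE.Torus.euclidDist ((Φ N).flow t z j).1 x₀ < h then ∫ y : EuclideanSpace ℝ (Fin 3), E ((Φ N).flow t z i).2 ((Φ N).flow t z j).2 (‖y‖⁻¹ • y) * max 0 (-(inner ℝ (((Φ N).flow t z i).2 - ((Φ N).flow t z j).2) y)) * Real.exp (-‖y‖ ^ 2) else 0; let nl := fun (N : ℕ) (z : Literature.Analysis.FluidPDE.Config (N + 1) (Fin 3) (UnitAddTorus (Fin 3))) => (∑ i : Fin (N + 1), if Literature.Analysis.FluidPDE.Torus.euclidDist ((Φ N).flow t z i).1 x₀ < h then (1 : ℝ) else 0) / ((N + 1 : ℝ) * (4 / 3 * Real.pi * h ^ 3)); let Pr := fun (N : ℕ) (z : Literature.Analysis.FluidPDE.Config (N + 1) (Fin 3) (UnitAddTorus (Fin 3))) =>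 ∑ i : Fin (N + 1), ∑ j : Fin (N + 1), if i ≠ j ∧ Literature.Analysis.FluidPDE.Torus.euclidDist ((Φ N).flow t z i).1 x₀ < h ∧ Literature.Analysis.FluidPDE.Torus.euclidDist ((Φ N).flow t z j).1 x₀ < h then Real.pi * (Literature.MathematicalPhysics.KineticTheory.hsDiameter σ N) ^ 2 * ‖((Φ N).flow t z i).2 - ((Φ N).flow t z j).2‖ * w N * ((Literature.MathematicalPhysics.KineticTheory.hsCompressibility (nl N z * σ ^ 3) - 1) / (2 * Real.pi / 3 * (nl N z * σ ^ 3))) / (4 / 3 * Real.pi * h ^ 3) else 0; Filter.Tendsto (fun N : ℕ => Literature.MathematicalPhysics.KineticTheory.localGibbsLaw σ a₀ u₀ θ₀ N (Φ N) {z | δ * Sc N z 1 * Sr N z 1 < |Sc N z F * Sr N z 1 - Sr N z F * Sc N z 1|}) Filter.atTop (nhds 0) ∧ Filter.Tendsto (fun N : ℕ => Literature.MathematicalPhysics.KineticTheory.localGibbsLaw σ a₀ u₀ θ₀ N (Φ N) {z | δ * Pr N z < |Sc N z 1 - Pr N z|}) Filter.atTop (nhds 0)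

/-- item stmt-AtomisticToContinuum-12126 · crux · rank 2 · open · by planner
why it might fail: A non-equilibrium bias in WHO recollides (compression/shear changing the re-aiming geometry at the free-path scale) would shift the ring fraction by O(1) if local equilibrium fails at scale ℓ; it also needs h → 0 after N → ∞ and N-stable equilibrium expectations r_E(N).
sources: AokiEtAl2015, PulvirentiSimonella2021, Dorfman1999, Cohen1967, BGSSCPAM2023
[crux] RING FRACTION TAKES ITS EQUILIBRIUM VALUE ALONG THE FLOW (card B1/B3 quantitative half): ∃ η₀
> 0, for all profiles ∃ σ₀, for σ < σ₀, M > 0, band-respecting classical solutions, flows with LLN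
at 0, t ∈ (0,T), δ > 0 ∃ h₀: for h < h₀, x₀ and every comparison flow family Ψ of N+1 spheres with
diameter parameter σ' = σρ_t(x₀)^(1/3) (same reduced density as the cell), P(|Z_ring −
r_E(N)·Z_coll| > δ Z_coll) → 0, where Z_coll/Z_ring count ordered (ring) collisions in cell × window
(M-rings: backward clusters over (s − w_N, s) intersect; clusters = time-respecting collision
chains, AokiEtAl2015 §1) and r_E(N) = E_Q[Z'_ring]/E_Q[Z'_coll] is the ring fraction of the
HOMOGENEOUS equilibrium system (canonical law, density 1, temperature θ_t(x₀), diameter σ', window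
of the same M kinetic units). MD-measurable. [difficulty: XL] -/
@[route_item "route-AtomisticToContinuum-RingDensityCertificate", crux]
def RingDensityLaw : Prop :=
  ∃ η₀ : ℝ, 0 < η₀ ∧ ∀ (a₀ θ₀ : UnitAddTorus (Fin 3) → ℝ) (u₀ : UnitAddTorus (Fin 3) → EuclideanSpace ℝ (Fin 3)), Continuous a₀ → Continuous θ₀ → Continuous u₀ → (∀ x, 0 < a₀ x) → (∀ x, 0 < θ₀ x) → ∃ σ₀ : ℝ, 0 < σ₀ ∧ ∀ σ : ℝ, 0 < σ → σ < σ₀ → ∀ M : ℝ, 0 < M → ∀ (T : ℝ) (ρ θ : ℝ → UnitAddTorus (Fin 3) → ℝ) (u : ℝ → UnitAddTorus (Fin 3) → EuclideanSpace ℝ (Fin 3)), Literature.MathematicalPhysics.KineticTheory.IsHardSphereEulerSolution σ T ρ u θ → (∀ t ∈ Set.Ico 0 T, ∀ x, ρ t x * σ ^ 3 < η₀) → ∀ Φ : (N : ℕ) → Literature.Analysis.FluidPDE.HardSphereFlow (Literature.Analysis.FluidPDE.Torus.geometry (Fin 3)) (Literature.MathematicalPhysics.KineticTheory.hsDiameter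 σ N) (N + 1), Literature.MathematicalPhysics.KineticTheory.TendstoHydroFieldsAt (fun N => Literature.MathematicalPhysics.KineticTheory.localGibbsLaw σ a₀ u₀ θ₀ N (Φ N)) Φ ρ u θ 0 → ∀ t ∈ Set.Ioo 0 T, ∀ δ : ℝ, 0 < δ → ∃ h₀ : ℝ, 0 < h₀ ∧ ∀ h : ℝ, 0 < h → h < h₀ → ∀ x₀ : UnitAddTorus (Fin 3), ∀ Ψ : (N : ℕ) → Literature.Analysis.FluidPDE.HardSphereFlow (Literature.Analysis.FluidPDE.Torus.geometry (Fin 3)) (Literature.MathematicalPhysics.KineticTheory.hsDiameter (σ * ρ t x₀ ^ (1 / 3 : ℝ)) N) (N + 1), let w : ℕ → ℝ := fun N => M / (σ ^ 2 * (ρ t x₀ * Real.sqrt (θ t x₀) * ((N + 1 : ℕ) : ℝ) ^ (1 / 3 : ℝ))); let w' : ℕ → ℝ := fun N => M / ((σ * ρ t x₀ ^ (1 / 3 : ℝ)) ^ 2 * (Real.sqrt (θ t x₀) * ((N + 1 : ℕ) : ℝ) ^ (1 / 3 : ℝ))); let Tc := fun (N : ℕ) (ε : ℝ) (γ : ℝ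 → Literature.Analysis.FluidPDE.Config (N + 1) (Fin 3) (UnitAddTorus (Fin 3))) (a ℓ r : ℝ) (i j : Fin (N + 1)) => {s : ℝ | s ∈ Set.Icc a (a + ℓ) ∧ γ s ∈ Literature.Analysis.FluidPDE.contactSet (Literature.Analysis.FluidPDE.Torus.geometry (Fin 3)) (N + 1) ε i j ∧ Literature.Analysis.FluidPDE.Torus.euclidDist (γ s i).1 x₀ < r}; let Bc := fun (N : ℕ) (ε : ℝ) (γ : ℝ → Literature.Analysis.FluidPDE.Config (N + 1) (Fin 3) (UnitAddTorus (Fin 3))) (a b : ℝ) (i : Fin (N + 1)) => {k : Fin (N + 1) | ∃ (m : ℕ) (p : Fin (m + 1) → Fin (N + 1)) (τ : Fin m → ℝ), p 0 = i ∧ p (Fin.last m) = k ∧ StrictAnti τ ∧ ∀ l : Fin m, τ l ∈ Set.Ico a b ∧ γ (τ l) ∈ Literature.Analysis.FluidPDE.contactSet (Literature.Analysis.FluidPDE.Torus.geometry (Fin 3)) (N + 1) ε (p l.castSucc) (p l.succ)}; let Zc := fun (N : ℕ) (ε : ℝ) (γ : ℝ → Literature.Analysis.FluidPDE.Config (N +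 1) (Fin 3) (UnitAddTorus (Fin 3))) (a ℓ r : ℝ) => ∑ i : Fin (N + 1), ∑ j : Fin (N + 1), if i ≠ j then ∑ᶠ s ∈ Tc N ε γ a ℓ r i j, (1 : ℝ) else 0; let Zr := fun (N : ℕ) (ε : ℝ) (γ : ℝ → Literature.Analysis.FluidPDE.Config (N + 1) (Fin 3) (UnitAddTorus (Fin 3))) (a ℓ r : ℝ) => ∑ i : Fin (N + 1), ∑ j : Fin (N + 1), if i ≠ j then ∑ᶠ s ∈ Tc N ε γ a ℓ r i j, Set.indicator {s' : ℝ | ∃ k, k ∈ Bc N ε γ (s' - ℓ) s' i ∧ k ∈ Bc N ε γ (s' - ℓ) s' j} 1 s else 0; let rE : ℕ → ℝ := fun N => (∫ z, Zr N (Literature.MathematicalPhysics.KineticTheory.hsDiameter (σ * ρ t x₀ ^ (1 / 3 : ℝ)) N) (fun s => (Ψ N).flow s z) 0 (w' N) 2 ∂Literature.MathematicalPhysics.KineticTheory.localGibbsLaw (σ * ρ t x₀ ^ (1 / 3 : ℝ)) 1 0 (fun _ => θ t x₀) N (Ψ N)) / (∫ z, Zc N (Literature.MathematicalPhysics.KineticTheory.hsDiameter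 (σ * ρ t x₀ ^ (1 / 3 : ℝ)) N) (fun s => (Ψ N).flow s z) 0 (w' N) 2 ∂Literature.MathematicalPhysics.KineticTheory.localGibbsLaw (σ * ρ t x₀ ^ (1 / 3 : ℝ)) 1 0 (fun _ => θ t x₀) N (Ψ N)); Filter.Tendsto (fun N : ℕ => Literature.MathematicalPhysics.KineticTheory.localGibbsLaw σ a₀ u₀ θ₀ N (Φ N) {z | δ * Zc N (Literature.MathematicalPhysics.KineticTheory.hsDiameter σ N) (fun s => (Φ N).flow s z) t (w N) h < |Zr N (Literature.MathematicalPhysics.KineticTheory.hsDiameter σ N) (fun s => (Φ N).flow s z) t (w N) h - rE N * Zc N (Literature.MathematicalPhysics.KineticTheory.hsDiameter σ N) (fun s => (Φ N).flow s z) t (w N) h|}) Filter.atTop (nhds 0)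

/-- item stmt-AtomisticToContinuum-12127 · crux · rank 3 · open · by planner
why it might fail: Large data: the tilt factor e^(ΛN) beats the extensive equilibrium rate e^(−c(δ,M)N) only for small amplitude; clusters grow like e^(CM) (AokiEtAl2015 Thm 1) so η(M,δ) ~ δe^(−2CM); a flow-generated excess of recollisions at fixed packing would refute it.
sources: AokiEtAl2015, PulvirentiSimonella2021, Janson2004, KipnisLandim1999, BGSSAnnals2023
[crux] TREE-LIKENESS OF NON-EQUILIBRIUM COLLISION HISTORIES (card B1, all amplitudes): for every
window multiplier M > 0 and δ > 0 there is a packing threshold η(M,δ) > 0 such that for all profiles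
∃ σ₀, for σ < σ₀, every classical solution with ρ_t(x)σ³ < η on [0,T), flows with LLN at 0, t ∈
(0,T), h > 0, x₀: P(Z_ring > δ·Z_coll in B(x₀,h) × [t, t+w_N]) → 0 as N → ∞. Small data:
EquilibriumRingLD + TiltTransfer + HomogeneousInvariance give it for ALL times (support
SmallDataRingSparsity); large data: zoom (card first-failure-blowup) or a super-extensive LD for the
time-integrated ring count (card spacetime-superextensive-ld). [difficulty: L] -/
@[route_item "route-AtomisticToContinuum-RingDensityCertificate", crux]
def RingSparsity : Prop :=
  ∀ M : ℝ, 0 < M → ∀ δ : ℝ, 0 < δ → ∃ η : ℝ, 0 < η ∧ ∀ (a₀ θ₀ : UnitAddTorus (Fin 3) → ℝ) (u₀ : UnitAddTorus (Fin 3) → EuclideanSpace ℝ (Fin 3)), Continuous a₀ → Continuous θ₀ → Continuous u₀ → (∀ x, 0 < a₀ x) → (∀ x, 0 < θ₀ x) → ∃ σ₀ : ℝ, 0 < σ₀ ∧ ∀ σ : ℝ, 0 < σ → σ < σ₀ → ∀ (T : ℝ) (ρ θ : ℝ → UnitAddTorus (Fin 3) → ℝ) (u : ℝ → UnitAddTorus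 (Fin 3) → EuclideanSpace ℝ (Fin 3)), Literature.MathematicalPhysics.KineticTheory.IsHardSphereEulerSolution σ T ρ u θ → (∀ t ∈ Set.Ico 0 T, ∀ x, ρ t x * σ ^ 3 < η) → ∀ Φ : (N : ℕ) → Literature.Analysis.FluidPDE.HardSphereFlow (Literature.Analysis.FluidPDE.Torus.geometry (Fin 3)) (Literature.MathematicalPhysics.KineticTheory.hsDiameter σ N) (N + 1), Literature.MathematicalPhysics.KineticTheory.TendstoHydroFieldsAt (fun N => Literature.MathematicalPhysics.KineticTheory.localGibbsLaw σ a₀ u₀ θ₀ N (Φ N)) Φ ρ u θ 0 → ∀ t ∈ Set.Ioo 0 T, ∀ h : ℝ, 0 < h → ∀ x₀ : UnitAddTorus (Fin 3), let w : ℕ → ℝ := fun N => M / (σ ^ 2 * (ρ t x₀ * Real.sqrt (θ t x₀) * ((N + 1 : ℕ) : ℝ) ^ (1 / 3 : ℝ))); let Tc := fun (N : ℕ) (ε : ℝ) (γ : ℝ → Literature.Analysis.FluidPDE.Config (N + 1) (Fin 3) (UnitAddTorus (Fin 3))) (a ℓ r : ℝ) (i j : Fin (N + 1)) => {s : ℝ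 | s ∈ Set.Icc a (a + ℓ) ∧ γ s ∈ Literature.Analysis.FluidPDE.contactSet (Literature.Analysis.FluidPDE.Torus.geometry (Fin 3)) (N + 1) ε i j ∧ Literature.Analysis.FluidPDE.Torus.euclidDist (γ s i).1 x₀ < r}; let Bc := fun (N : ℕ) (ε : ℝ) (γ : ℝ → Literature.Analysis.FluidPDE.Config (N + 1) (Fin 3) (UnitAddTorus (Fin 3))) (a b : ℝ) (i : Fin (N + 1)) => {k : Fin (N + 1) | ∃ (m : ℕ) (p : Fin (m + 1) → Fin (N + 1)) (τ : Fin m → ℝ), p 0 = i ∧ p (Fin.last m) = k ∧ StrictAnti τ ∧ ∀ l : Fin m, τ l ∈ Set.Ico a b ∧ γ (τ l) ∈ Literature.Analysis.FluidPDE.contactSet (Literature.Analysis.FluidPDE.Torus.geometry (Fin 3)) (N + 1) ε (p l.castSucc) (p l.succ)}; let Zc := fun (N : ℕ) (ε : ℝ) (γ : ℝ → Literature.Analysis.FluidPDE.Config (N + 1) (Fin 3) (UnitAddTorus (Fin 3))) (a ℓ r : ℝ) => ∑ i : Fin (N + 1), ∑ j : Fin (N + 1), if i ≠ j then ∑ᶠ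 s ∈ Tc N ε γ a ℓ r i j, (1 : ℝ) else 0; let Zr := fun (N : ℕ) (ε : ℝ) (γ : ℝ → Literature.Analysis.FluidPDE.Config (N + 1) (Fin 3) (UnitAddTorus (Fin 3))) (a ℓ r : ℝ) => ∑ i : Fin (N + 1), ∑ j : Fin (N + 1), if i ≠ j then ∑ᶠ s ∈ Tc N ε γ a ℓ r i j, Set.indicator {s' : ℝ | ∃ k, k ∈ Bc N ε γ (s' - ℓ) s' i ∧ k ∈ Bc N ε γ (s' - ℓ) s' j} 1 s else 0; Filter.Tendsto (fun N : ℕ => Literature.MathematicalPhysics.KineticTheory.localGibbsLaw σ a₀ u₀ θ₀ N (Φ N) {z | δ * Zc N (Literature.MathematicalPhysics.KineticTheory.hsDiameter σ N) (fun s => (Φ N).flow s z) t (w N) h < Zr N (Literature.MathematicalPhysics.KineticTheory.hsDiameter σ N) (fun s => (Φ N).flow s z) t (w N) h}) Filter.atTop (nhds 0)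

/-- item stmt-AtomisticToContinuum-12128 · crux · rank 4 · open · by planner
why it might fail: No Cauchy–Schwarz/Gram identity is known for time-ordered collision motifs: a velocity-correlated state with EQUILIBRIUM ring density (e.g. shear-aligned pairs) would make the certificate blind; the far-field input (off-contact k-body LE) is itself open at fixed σ.
sources: ChungGrahamWilson1989, ChungGraham2002, doi:10.1002/jgt.21701, AokiEtAl2015, PulvirentiSimonella2016, Lutsko1996
[crux] RING DENSITY CERTIFIES CHAOS (card's programme form, CGW-type rigidity for time-ordered
collision forests): in the sparse regime (RingSparsity), equality of the window ring fraction with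
its equilibrium value at the local state (RingDensityLaw) forces the empirical Stosszahlansatz
(ContactChaos). Intended mechanism: ancestry lemma (at fresh collisions incoming data come from
disjoint backward clusters, so correlation is only inherited from the mesoscopic far field at the
window start) + "excess correlation forces excess/deficient short cycles" (codegree ⇒ edge
uniformity, ChungGrahamWilson1989 Thm 1 analogue; sparse ChungGraham2002; oriented
doi:10.1002/jgt.21701) + rings-in-a-local-equilibrium-medium for the ring minority; flag-algebra/SDP
certificates over ≤ 4-collision motifs as the search tool. [deps: RingSparsity, RingDensityLaw,
ContactChaos] [difficulty: open-problem] -/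
@[route_item "route-AtomisticToContinuum-RingDensityCertificate", crux]
def RingCertificate : Prop :=
  RingSparsity → RingDensityLaw → ContactChaos

/-- item stmt-AtomisticToContinuum-12129 · crux · rank 5 · open · by planner
why it might fail: Chaos tested by bounded F in shrinking cells may be too weak for a quantitative H-theorem on EMPIRICAL measures (atomic measures have no entropy: smoothing + Cercignani-type production bounds, DesvillettesVillani2005); mv limits need the exact hs entropy inequality.
sources: Resibois1978, BrezinaFeireisl2018, Dafermos1979, DesvillettesVillani2005, Bogolyubov1975, Lachowicz1998
[crux] EMPIRICAL ENSKOG CHAOS CLOSES hs-EULER IN THE PACKING BAND: ContactChaos → HydroLimitInBand,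
the packing-guarded conjunct (ex stmt-AtomisticToContinuum-3093, inlined verbatim as the consequent:
∃ η₀ > 0 ∀ profiles ∃ σ₀ ∀ σ < σ₀ ∀ classical solutions with ρ_t(x)σ³ < η₀ on [0,T) ∀ flows, LLN at
0 ⇒ LLN at every t < T). Intended proof: Bogolyubov's exact empirical identity for (μ^N, collision
measure) (Bogolyubov1975) + SEL/ANG/RATE ⇒ empirical revised-Enskog structure in every cell/window ⇒
H-theorem (Resibois1978) ⇒ cell velocity laws relax to local Maxwellians within O(1) kinetic times,
entropy production ≥ 0 ⇒ kinetic + collisional fluxes = (ρu⊗u + ρθZ(ρσ³)𝟙, (E+p)u) and the hs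
entropy inequality for limit points ⇒ dissipative measure-valued solution ⇒ relative-entropy
weak–strong uniqueness (Dafermos1979, BrezinaFeireisl2018) ⇒ fields converge for t < T; velocity
tails by transfer of Gaussian moments against the invariant law. [deps: ContactChaos] [difficulty:
XL] -/
@[route_item "route-AtomisticToContinuum-RingDensityCertificate", crux]
def ChaosClosure : Prop :=
  ContactChaos → ∃ η₀ : ℝ, 0 < η₀ ∧ ∀ (a₀ θ₀ : Literature.MathematicalPhysics.KineticTheory.T3 → ℝ) (u₀ : Literature.MathematicalPhysics.KineticTheory.T3 → Literature.MathematicalPhysics.KineticTheory.V3), Continuous a₀ → Continuous θ₀ → Continuous u₀ → (∀ x, 0 < a₀ x) → (∀ x, 0 < θ₀ x) → ∃ σ₀ : ℝ, 0 < σ₀ ∧ ∀ σ : ℝ, 0 < σ → σ < σ₀ → ∀ (T : ℝ) (ρ θ : ℝ → Literature.MathematicalPhysics.KineticTheory.T3 → ℝ) (u : ℝ → Literature.MathematicalPhysics.KineticTheory.T3 → Literature.MathematicalPhysics.KineticTheory.V3), Literature.MathematicalPhysics.KineticTheory.IsHardSphereEulerSolution σ T ρ u θ → (∀ t ∈ Set.Ico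 0 T, ∀ x, ρ t x * σ ^ 3 < η₀) → ∀ Φ : (N : ℕ) → Literature.Analysis.FluidPDE.HardSphereFlow (Literature.Analysis.FluidPDE.Torus.geometry (Fin 3)) (Literature.MathematicalPhysics.KineticTheory.hsDiameter σ N) (N + 1), Literature.MathematicalPhysics.KineticTheory.TendstoHydroFieldsAt (fun N => Literature.MathematicalPhysics.KineticTheory.localGibbsLaw σ a₀ u₀ θ₀ N (Φ N)) Φ ρ u θ 0 → ∀ t ∈ Set.Ico 0 T, Literature.MathematicalPhysics.KineticTheory.TendstoHydroFieldsAt (fun N => Literature.MathematicalPhysics.KineticTheory.localGibbsLaw σ a₀ u₀ θ₀ N (Φ N)) Φ ρ u θ t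

/-- item stmt-AtomisticToContinuum-12130 · support · rank 9 · open · by planner
sources: Janson2004, KipnisLandim1999, Ruelle1969, AokiEtAl2015
[support] EXTENSIVE EQUILIBRIUM LARGE DEVIATIONS FOR THE RING FRACTION (card B1(a)): for θc > 0, M >
0, δ > 0 ∃ σ₀, for σ < σ₀ and h > 0 ∃ C > 0 such that under the homogeneous canonical law Q_N
(activity 1, velocity 0, temperature θc) of N+1 spheres, for every t, x₀, flow family and N:
Q_N(|Z_ring − r_E(N) Z_coll| > δ Z_coll in B(x₀,h) × [t, t+w_N]) ≤ C e^(−(N+1)/C), r_E(N) =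
E_Q[Z_ring]/E_Q[Z_coll], w_N = M/(σ²√θc (N+1)^(1/3)). Proof sketch: velocity truncation (Gaussian
tails), spatial near-independence of mesoscopic sub-cells over a microscopic window +
dependency-graph Bernstein/Janson bound inside, canonical-constraint decoupling; stationarity makes
C independent of t. [difficulty: M] -/
@[route_item "route-AtomisticToContinuum-RingDensityCertificate"]
def EquilibriumRingLD : Prop :=
  ∀ θc : ℝ, 0 < θc → ∀ M : ℝ, 0 < M → ∀ δ : ℝ, 0 < δ → ∃ σ₀ : ℝ, 0 < σ₀ ∧ ∀ σ : ℝ, 0 < σ → σ < σ₀ → ∀ h : ℝ, 0 < h → ∃ C : ℝ, 0 < C ∧ ∀ (t : ℝ) (x₀ : UnitAddTorus (Fin 3)) (Φ : (N : ℕ) → Literature.Analysis.FluidPDE.HardSphereFlow (Literature.Analysis.FluidPDE.Torus.geometry (Fin 3)) (Literature.MathematicalPhysics.KineticTheory.hsDiameter σ N) (N + 1)), let w : ℕ → ℝ := fun N => M / (σ ^ 2 * (Real.sqrt (θc) * ((N + 1 : ℕ) : ℝ) ^ (1 / 3 : ℝ))); let Tc := fun (N : ℕ) (ε : ℝ) (γ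 : ℝ → Literature.Analysis.FluidPDE.Config (N + 1) (Fin 3) (UnitAddTorus (Fin 3))) (a ℓ r : ℝ) (i j : Fin (N + 1)) => {s : ℝ | s ∈ Set.Icc a (a + ℓ) ∧ γ s ∈ Literature.Analysis.FluidPDE.contactSet (Literature.Analysis.FluidPDE.Torus.geometry (Fin 3)) (N + 1) ε i j ∧ Literature.Analysis.FluidPDE.Torus.euclidDist (γ s i).1 x₀ < r}; let Bc := fun (N : ℕ) (ε : ℝ) (γ : ℝ → Literature.Analysis.FluidPDE.Config (N + 1) (Fin 3) (UnitAddTorus (Fin 3))) (a b : ℝ) (i : Fin (N + 1)) => {k : Fin (N + 1) | ∃ (m : ℕ) (p : Fin (m + 1) → Fin (N + 1)) (τ : Fin m → ℝ), p 0 = i ∧ p (Fin.last m) = k ∧ StrictAnti τ ∧ ∀ l : Fin m, τ l ∈ Set.Ico a b ∧ γ (τ l) ∈ Literature.Analysis.FluidPDE.contactSet (Literature.Analysis.FluidPDE.Torus.geometry (Fin 3)) (N + 1) ε (p l.castSucc) (p l.succ)}; let Zc := fun (N : ℕ) (ε : ℝ) (γ : ℝ → Literature.Analysis.FluidPDE.Config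 (N + 1) (Fin 3) (UnitAddTorus (Fin 3))) (a ℓ r : ℝ) => ∑ i : Fin (N + 1), ∑ j : Fin (N + 1), if i ≠ j then ∑ᶠ s ∈ Tc N ε γ a ℓ r i j, (1 : ℝ) else 0; let Zr := fun (N : ℕ) (ε : ℝ) (γ : ℝ → Literature.Analysis.FluidPDE.Config (N + 1) (Fin 3) (UnitAddTorus (Fin 3))) (a ℓ r : ℝ) => ∑ i : Fin (N + 1), ∑ j : Fin (N + 1), if i ≠ j then ∑ᶠ s ∈ Tc N ε γ a ℓ r i j, Set.indicator {s' : ℝ | ∃ k, k ∈ Bc N ε γ (s' - ℓ) s' i ∧ k ∈ Bc N ε γ (s' - ℓ) s' j} 1 s else 0; let rE : ℕ → ℝ := fun N => (∫ z, Zr N (Literature.MathematicalPhysics.KineticTheory.hsDiameter σ N) (fun s => (Φ N).flow s z) t (w N) h ∂Literature.MathematicalPhysics.KineticTheory.localGibbsLaw σ 1 0 (fun _ => θc) N (Φ N)) / (∫ z, Zc N (Literature.MathematicalPhysics.KineticTheory.hsDiameter σ N) (fun s => (Φ N).flow s z) t (w N) h ∂Literature.MathematicalPhysics.KineticTheory.localGibbsLaw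 σ 1 0 (fun _ => θc) N (Φ N)); ∀ N : ℕ, Literature.MathematicalPhysics.KineticTheory.localGibbsLaw σ 1 0 (fun _ => θc) N (Φ N) {z | δ * Zc N (Literature.MathematicalPhysics.KineticTheory.hsDiameter σ N) (fun s => (Φ N).flow s z) t (w N) h < |Zr N (Literature.MathematicalPhysics.KineticTheory.hsDiameter σ N) (fun s => (Φ N).flow s z) t (w N) h - rE N * Zc N (Literature.MathematicalPhysics.KineticTheory.hsDiameter σ N) (fun s => (Φ N).flow s z) t (w N) h|} ≤ ENNReal.ofReal (C * Real.exp (-(C⁻¹ * (N + 1))))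

/-- item stmt-AtomisticToContinuum-12131 · support · rank 9 · closed · proved by Summit.AtomisticToContinuum.HydrodynamicLimit.Theorems.tiltTransfer_proof @ 80d4fabbfc0d (prover) · by planner
sources: KipnisLandim1999, Spohn1991, GST2013
[support] CAUCHY–SCHWARZ TRANSFER AGAINST THE INVARIANT LAW (card B4), dilute form: for 0 < σ < 1/4,
continuous positive profiles (a₀,u₀,θ₀) and θc with θ₀ < 2θc pointwise there is Λ such that for all
N, flows Φ, times t and measurable B: (lawAt Φ P_N t)(B) ≤ e^(Λ(N+1)) · Q_N(B)^(1/2), P_N =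
localGibbsLaw σ a₀ u₀ θ₀ N Φ, Q_N = homogeneous law (1, 0, θc). Proof: P_t(B) = ∫ 1_B∘Φ_t · (dP/dQ)
dQ ≤ Q(Φ_t⁻¹B)^(1/2) ‖dP/dQ‖_(L²(Q)), invariance of Q (HomogeneousInvariance), ‖dP/dQ‖² ≤
(Z_Q/Z_P²)·K^(N+1) with K = sup_x ∫ (a₀M_(u₀,θ₀))²/M_(0,θc) dv < ∞ iff θ₀ < 2θc, Z_P ≥ (inf
a₀)^(N+1) Z_Q and Z_Q ≥ (1 − (32π/3)σ³)^(N+1) by sequential insertion (σ < 1/4); both sides vanish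
when the partition function does. [difficulty: provable-now] -/
@[route_item "route-AtomisticToContinuum-RingDensityCertificate"]
def TiltTransfer : Prop :=
  ∀ σ : ℝ, 0 < σ → σ < 1 / 4 → ∀ (a₀ θ₀ : UnitAddTorus (Fin 3) → ℝ) (u₀ : UnitAddTorus (Fin 3) → EuclideanSpace ℝ (Fin 3)) (θc : ℝ), Continuous a₀ → Continuous θ₀ → Continuous u₀ → (∀ x, 0 < a₀ x) → (∀ x, 0 < θ₀ x) → (∀ x, θ₀ x < 2 * θc) → ∃ Λ : ℝ, ∀ (N : ℕ) (Φ : Literature.Analysis.FluidPDE.HardSphereFlow (Literature.Analysis.FluidPDE.Torus.geometry (Fin 3)) (Literature.MathematicalPhysics.KineticTheory.hsDiameter σ N) (N + 1)) (t : ℝ) (B : Set (Literature.Analysis.FluidPDE.Config (N + 1) (Fin 3) (UnitAddTorus (Fin 3)))), MeasurableSet B → (Φ.lawAt (Literature.MathematicalPhysics.KineticTheory.localGibbsLaw σ a₀ u₀ θ₀ N Φ) t) B ≤ ENNReal.ofReal (Real.exp (Λ * (N + 1))) * (Literature.MathematicalPhysics.KineticTheory.localGibbsLaw σ 1 0 (fun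 _ => θc) N Φ B) ^ (1 / 2 : ℝ)

/-- item stmt-AtomisticToContinuum-12132 · support · rank 9 · open · by planner
sources: Janson2004, KipnisLandim1999, AokiEtAl2015, Dorfman1999
[support] SMALL-DATA TREE-LIKENESS FOR ALL TIMES (card B1(a)+(b), the concrete deliverable): for c,
θc > 0, M > 0, δ > 0 ∃ σ₀, for σ < σ₀ ∃ η₀ > 0 such that for continuous positive profiles within η₀
of the constants (|a₀−c|, ‖u₀‖, |θ₀−θc| ≤ η₀), every flow family, EVERY time t ∈ ℝ, h > 0, x₀:
P_N(Z_ring > δ Z_coll in B(x₀,h) × [t, t+w_N]) → 0, w_N = M/(σ²√θc(N+1)^(1/3)). From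
EquilibriumRingLD (+ smallness of r_E: r_E(N) ≤ δ/2 for σ < σ₀(M,δ,c), an Enskog-level three-body
re-aiming computation, Dorfman1999 §16) and TiltTransfer with Λ(η₀) < 1/(2C): a rigorous dynamical
statement at fixed density valid for all macroscopic times with no mixing input. [difficulty: M] -/
@[route_item "route-AtomisticToContinuum-RingDensityCertificate"]
def SmallDataRingSparsity : Prop :=
  ∀ (c θc : ℝ), 0 < c → 0 < θc → ∀ M : ℝ, 0 < M → ∀ δ : ℝ, 0 < δ → ∃ σ₀ : ℝ, 0 < σ₀ ∧ ∀ σ : ℝ, 0 < σ → σ < σ₀ → ∃ η₀ : ℝ, 0 < η₀ ∧ ∀ (a₀ θ₀ : UnitAddTorus (Fin 3) → ℝ) (u₀ : UnitAddTorus (Fin 3) → EuclideanSpace ℝ (Fin 3)), Continuous a₀ → Continuous θ₀ → Continuous u₀ → (∀ x, 0 < a₀ x) → (∀ x, 0 < θ₀ x) → (∀ x, |a₀ x - c| ≤ η₀ ∧ ‖u₀ x‖ ≤ η₀ ∧ |θ₀ x - θc| ≤ η₀) → ∀ Φ : (N : ℕ) → Literature.Analysis.FluidPDE.HardSphereFlow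 (Literature.Analysis.FluidPDE.Torus.geometry (Fin 3)) (Literature.MathematicalPhysics.KineticTheory.hsDiameter σ N) (N + 1), ∀ (t : ℝ) (h : ℝ), 0 < h → ∀ x₀ : UnitAddTorus (Fin 3), let w : ℕ → ℝ := fun N => M / (σ ^ 2 * (Real.sqrt (θc) * ((N + 1 : ℕ) : ℝ) ^ (1 / 3 : ℝ))); let Tc := fun (N : ℕ) (ε : ℝ) (γ : ℝ → Literature.Analysis.FluidPDE.Config (N + 1) (Fin 3) (UnitAddTorus (Fin 3))) (a ℓ r : ℝ) (i j : Fin (N + 1)) => {s : ℝ | s ∈ Set.Icc a (a + ℓ) ∧ γ s ∈ Literature.Analysis.FluidPDE.contactSet (Literature.Analysis.FluidPDE.Torus.geometry (Fin 3)) (N + 1) ε i j ∧ Literature.Analysis.FluidPDE.Torus.euclidDist (γ s i).1 x₀ < r}; let Bc := fun (N : ℕ) (ε : ℝ) (γ : ℝ → Literature.Analysis.FluidPDE.Config (N + 1) (Fin 3) (UnitAddTorus (Fin 3))) (a b : ℝ) (i : Fin (N + 1)) => {k : Fin (N + 1) | ∃ (m : ℕ) (p : Fin (m + 1) → Fin (N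 + 1)) (τ : Fin m → ℝ), p 0 = i ∧ p (Fin.last m) = k ∧ StrictAnti τ ∧ ∀ l : Fin m, τ l ∈ Set.Ico a b ∧ γ (τ l) ∈ Literature.Analysis.FluidPDE.contactSet (Literature.Analysis.FluidPDE.Torus.geometry (Fin 3)) (N + 1) ε (p l.castSucc) (p l.succ)}; let Zc := fun (N : ℕ) (ε : ℝ) (γ : ℝ → Literature.Analysis.FluidPDE.Config (N + 1) (Fin 3) (UnitAddTorus (Fin 3))) (a ℓ r : ℝ) => ∑ i : Fin (N + 1), ∑ j : Fin (N + 1), if i ≠ j then ∑ᶠ s ∈ Tc N ε γ a ℓ r i j, (1 : ℝ) else 0; let Zr := fun (N : ℕ) (ε : ℝ) (γ : ℝ → Literature.Analysis.FluidPDE.Config (N + 1) (Fin 3) (UnitAddTorus (Fin 3))) (a ℓ r : ℝ) => ∑ i : Fin (N + 1), ∑ j : Fin (N + 1), if i ≠ j then ∑ᶠ s ∈ Tc N ε γ a ℓ r i j, Set.indicator {s' : ℝ | ∃ k, k ∈ Bc N ε γ (s' - ℓ) s' i ∧ k ∈ Bc N ε γ (s' - ℓ) s' j} 1 s else 0; Filter.Tendsto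 (fun N : ℕ => Literature.MathematicalPhysics.KineticTheory.localGibbsLaw σ a₀ u₀ θ₀ N (Φ N) {z | δ * Zc N (Literature.MathematicalPhysics.KineticTheory.hsDiameter σ N) (fun s => (Φ N).flow s z) t (w N) h < Zr N (Literature.MathematicalPhysics.KineticTheory.hsDiameter σ N) (fun s => (Φ N).flow s z) t (w N) h}) Filter.atTop (nhds 0)

/-- item stmt-AtomisticToContinuum-9621 · support · rank 9 · closed · proved by Summit.AtomisticToContinuum.HydrodynamicLimit.Theorems.homogeneousInvariance_proof @ 733069bd6ec4 (prover) · by planner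
sources: GST2013, CIP1994, Alexander1975
[support] (= stmt-AtomisticToContinuum-3073 verbatim, shared with OneParticleInfluence /
HomoenergeticRung) the canonical law with constant profiles is invariant under every hard-sphere
flow, lawAt Φ p t = p (Liouville preservation + energy and momentum conservation on the good set;
rests on PROVED cone facts). Gives E_G[X_t] = E_G[X_0] = the equilibrium values subtracted in
SoundWindow. [difficulty: provable-now] -/
@[route_item "route-AtomisticToContinuum-RingDensityCertificate"]
def HomogeneousInvariance : Prop :=
  ∀ (σ c θc : ℝ) (uc : Literature.MathematicalPhysics.KineticTheory.V3), 0 < σ → 0 < c → 0 < θc → ∀ (N : ℕ) (Φ : Literature.Analysis.FluidPDE.HardSphereFlow (Literature.Analysis.FluidPDE.Torus.geometry (Fin 3)) (Literature.MathematicalPhysics.KineticTheory.hsDiameter σ N) (N + 1)) (t : ℝ), Φ.lawAt (Literature.MathematicalPhysics.KineticTheory.localGibbsLaw σ (fun _ => c) (fun _ => uc) (fun _ => θc) N Φ) t = Literature.MathematicalPhysics.KineticTheory.localGibbsLaw σ (fun _ => c) (fun _ => uc) (fun _ => θc) N Φ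

/-- `HomogeneousInvariance` holds: proved by `Summit.AtomisticToContinuum.HydrodynamicLimit.Theorems.homogeneousInvariance_proof` @ 733069bd6ec4. -/
theorem HomogeneousInvariance_holds : HomogeneousInvariance := _root_.Summit.AtomisticToContinuum.HydrodynamicLimit.Theorems.homogeneousInvariance_proof

-- earlier Assembly (stmt-AtomisticToContinuum-12133, replaced 2026-08-16T23:42:24Z -> stmt-AtomisticToContinuum-17871): proved by Summit.AtomisticToContinuum.HydrodynamicLimit.Theorems.ringDensityCertificateAssembly_proof @ 2b7c8b0311b0 — RingSparsity → RingDensityLaw → RingCertificate → ChaosClosure → DiluteSelfConsistency → _root_.HydrodynamicLimit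
/-- item stmt-AtomisticToContinuum-17871 · assembly · rank 1 · open · by planner
sources: Spohn1991, OllaVaradhanYau1993, ChungGrahamWilson1989
[assembly] RingSparsity → RingDensityLaw → ChaosClosure → HydrodynamicLimit — the frame "inputs ⇒
Statement" after the Statement re-type D-0032 (p126922): the two measurable collision-forest inputs
(tree-likeness, equilibrium ring fraction) and the kinetic closure imply the packing-guarded
conjunct. A WEAKENING of the certificate crux RingCertificate (it closes by `fun hS hR hCl => hCl
(ringCertificate hS hR)` the moment RingCertificate closes; Sketch.lean rc 0); `closes` does not
take Assembly as a hypothesis; not battery-provable (its antecedents are open cruxes;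
tauto/aesop/simp_all fail, Sketch.lean). Replaces the rev-0 frame stmt-12133 `RingSparsity →
RingDensityLaw → RingCertificate → ChaosClosure → DiluteSelfConsistency → HydrodynamicLimit`, proved
against the OLD unguarded abbrev (Theorems/RingDensityCertificateAssembly.lean @2b7c8b03) and
tauto-trivial against the re-typed Statement (ground.trivial), whose idle antecedent
DiluteSelfConsistency leaves the route with it. [difficulty: closes with RingCertificate] -/
@[route_item "route-AtomisticToContinuum-RingDensityCertificate"]
def Assembly : Prop :=
  RingSparsity → RingDensityLaw → ChaosClosure → _root_.HydrodynamicLimit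

/-! D-0027 §2.1 — DECIDING THEOREM (planner-authored via `route open/edit --closes-file`; by planner-rrepair-AtomisticToContinuum-RingDensi-4838805e-0 2026-08-16T23:51:01Z):
its hypotheses are this route's items and its conclusion the sub-problem Statement (glue_lint), and it elaborates with this file. -/

@[closes "route-AtomisticToContinuum-RingDensityCertificate"] theorem closes (hRing : RingDensityLaw) (hSparse : RingSparsity) (hCert : RingCertificate) (hClose : ChaosClosure) : _root_.HydrodynamicLimit :=
  -- crux-only deciding theorem (statement re-type D-0032, p126922): the certificate cruxes give the
  -- target `ContactChaos`; `ChaosClosure` maps it to the packing-guarded conjunct, which IS the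
  -- re-typed Statement verbatim — no support item and no packing-band lift is consumed.
  have hTarget : ContactChaos := hCert hSparse hRing
  hClose hTarget

end Summit.AtomisticToContinuum.HydrodynamicLimit.Theses.RingDensityCertificate
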